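import Summits.QuantumFields.QCD.Theses.SpectralDefectExtinction
import Literature.MathematicalPhysics.QuantumFieldTheory.SpectralDefectDensity
import Literature.MathematicalPhysics.QuantumFieldTheory.QCDPhaseQuenched
import Literature.Barriers.QuantumFields.WilsonDeterminantMassSplitting
import Literature.MathematicalPhysics.QuantumLattice.WilsonFermionBlockAveraging
import Summits.QuantumFields.QCD.Theorems.WegnerEstimate.Negative.PositivityReduction

/-!
# Crux `WegnerEstimate` (item stmt-QuantumFields-8966), negative side — load-bearing analysis

Support file of the standing disprover (`refuter-cdisprove-stmt-QuantumFields-8966-0`) of the crux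
`Summit.QuantumFields.QCD.Theses.SpectralDefectExtinction.WegnerEstimate`
(`∃ C > 0, p ≥ 0, ∀ β ≥ 1, L ≥ 2, m₀ ∈ [-1,0], ε ∈ (0,1]:
E_{Wilson(β,L)} #{eigenvalues of γ₅ D_W(U,m₀,1) in (-ε,ε)} ≤ C (1+β^p) ε L⁴`; verbatim shared
with `WilsonMobilityGap.WegnerEstimate`).  Everything here is sorry-free and theorem-only (the
statements are written out; the disprover's work file `Cruxes/WegnerEstimate/Disproof.lean` has the
same content with abbreviations, plus the sorry'd near-miss `toronFloor`).

* `windowCount_le_dim`, `expWindowCount_le_dim`, `expWindowCount_nonneg`,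
  `expWindowCount_eq_zero_of_nonpos`: the integrand is `≤ 12 L⁴`, the expectation lies in
  `[0, 12 L⁴]` and vanishes for `ε ≤ 0` (the Wilson measure is a probability measure).
* `wegnerEstimate_false_without_epsPos` (**load-bearing**): with `0 < ε` dropped the statement is
  false (`ε = -1`).
* `wegnerEstimate_iff_allEps` (**not load-bearing**): `ε ≤ 1` may be dropped.
* `wegnerEstimate_restricted_to_eps_ge`: restricted to `ε ≥ ε₀ > 0` the bound holds with
  `C = 12/ε₀`, `p = 0` — all content is at `ε → 0`.
* `wegnerEstimate_imp_holder`: the crux implies every Hölder variant `ε^α`, `α ≤ 1` (the planners'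
  repair target if the linear estimate resists: the route's extinction exponent only loses
  `(1-α)/(4b₀)`).
* `hermitianWilsonDirac_mul_self` (`(Γ₅D)² = DᴴD`: the count is a SINGULAR-VALUE count of the
  non-normal `D_W(U,m₀,1)`), `hermitianWilsonDirac_mass_shift` (`Γ₅D(m₀) = Γ₅D(0) + m₀Γ₅`: the
  mass is a non-sign-definite perturbation, no spectral monotonicity).
* (sibling file `Negative/PositivityReduction.lean`: the Wilson-positivity reduction — a window
  eigenvalue forces a unit field of covariant Dirichlet energy `< ε - m₀` — and the converse
  singular-value criterion.)
* `spinorLift_gammaFive_mul_gaugeRotation`, `hermitianWilsonDirac_gaugeTransform`,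
  `charpoly_hermitianWilsonDirac_gaugeTransform`, `window_pureGauge_pos` (**gauge invariance**):
  `γ₅D_W(U^g) = 𝒢(g) γ₅D_W(U) 𝒢(g)⁻¹`, so the window count is constant on gauge orbits; with the
  sibling file's `window_one_pos`, EVERY pure gauge `U = 1^g` has `N(ε; U, m₀) ≥ 1` for `ε > |m₀|`
  (the configuration-wise half of the toron floor, on the whole orbit the Wilson measure
  concentrates around as `β → ∞`).
* `not_wegnerEstimate_pZero_of_toronFloor` (**tightness, modulo the toron floor**): IF on the `2⁴`
  torus windows of vanishing width keep expected count `≥ c > 0` as `β` varies (the toron mechanism: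
  holonomy `|θ| ≍ β^{-1/4}` in the trivial centre sector, 12 modes of `γ₅D_W(U,0,1)` at `≈ ±|θ^a|/2`,
  plateau `12/81`), THEN the `β`-uniform (`p = 0`) strengthening of the crux is false; so any proof
  must spend `p > 0` (heuristically `p ≥ 1/4`).

[folklore] for the linear algebra; the toron floor is a hypothesis here, not a fact.
-/

namespace Summit.QuantumFields.QCD.Theorems.WegnerEstimateNegative

open MeasureTheory
open scoped Matrix
open Literature.MathematicalPhysics.QuantumLattice Literature.MathematicalPhysics.QuantumFieldTheory
  Literature.Probability.LatticeModels
open Summit.QuantumFields.QCD.Theses.SpectralDefectExtinction (WegnerEstimate)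
open Literature.Barriers.QuantumFields (wilsonDirac_add_mass isHermitian_gammaFive_mul_wilsonDirac)
open Matrix

/-! ## The count is at most the dimension -/

/-- `N(ε; U, m₀) ≤ 12 L⁴` (roots of the characteristic polynomial of a `12L⁴ × 12L⁴` matrix).
[folklore] -/
theorem windowCount_le_dim {L : ℕ} [NeZero L] (U : GaugeConfig 4 L SU3) (m₀ ε : ℝ) :
    Multiset.countP (fun z : ℂ => |z.re| < ε) (spinorLift gammaFive * wilsonDirac (fundamentalRep (Fin 3)) U m₀ 1).charpoly.roots ≤ 12 * L ^ 4 := by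
  calc Multiset.countP (fun z : ℂ => |z.re| < ε) (spinorLift gammaFive * wilsonDirac (fundamentalRep (Fin 3)) U m₀ 1).charpoly.roots
      ≤ Multiset.card
          (spinorLift gammaFive * wilsonDirac (fundamentalRep (Fin 3)) U m₀ 1).charpoly.roots :=
        Multiset.countP_le_card _ _
    _ ≤ (spinorLift gammaFive * wilsonDirac (fundamentalRep (Fin 3)) U m₀ 1).charpoly.natDegree :=
        Polynomial.card_roots' _
    _ = Fintype.card (QuarkIdx L) := Matrix.charpoly_natDegree_eq_dim _
    _ = 12 * L ^ 4 := card_quarkIdx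

/-- Cast form of `windowCount_le_dim`. [folklore] -/
theorem windowCount_cast_le_dim {L : ℕ} [NeZero L] (U : GaugeConfig 4 L SU3) (m₀ ε : ℝ) :
    (Multiset.countP (fun z : ℂ => |z.re| < ε) (spinorLift gammaFive * wilsonDirac (fundamentalRep (Fin 3)) U m₀ 1).charpoly.roots : ℝ) ≤ 12 * (L : ℝ) ^ 4 := by
  exact_mod_cast windowCount_le_dim U m₀ ε

/-- For `ε ≤ 0` the window `|Re z| < ε` is empty. [folklore] -/
theorem windowCount_eq_zero_of_nonpos {L : ℕ} [NeZero L] (U : GaugeConfig 4 L SU3) (m₀ : ℝ)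
    {ε : ℝ} (hε : ε ≤ 0) : Multiset.countP (fun z : ℂ => |z.re| < ε) (spinorLift gammaFive * wilsonDirac (fundamentalRep (Fin 3)) U m₀ 1).charpoly.roots = 0 := by
  rw [Multiset.countP_eq_zero]
  intro z _ hz
  exact absurd (lt_of_lt_of_le hz hε) (not_lt.2 (abs_nonneg z.re))

/-- The count is monotone in the window. [folklore] -/
theorem windowCount_mono {L : ℕ} [NeZero L] (U : GaugeConfig 4 L SU3) (m₀ : ℝ) {ε ε' : ℝ}
    (h : ε ≤ ε') : Multiset.countP (fun z : ℂ => |z.re| < ε) (spinorLift gammaFive * wilsonDirac (fundamentalRep (Fin 3)) U m₀ 1).charpoly.roots ≤ Multiset.countP (fun z : ℂ => |z.re| < ε') (spinorLift gammaFive * wilsonDirac (fundamentalRep (Fin 3)) U m₀ 1).charpoly.roots := by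
  simp only [Multiset.countP_eq_card_filter]
  exact Multiset.card_le_card
    (Multiset.monotone_filter_right _ fun z (hz : |z.re| < ε) => lt_of_lt_of_le hz h)

/-- `0 ≤ E N`. [folklore] -/
theorem expWindowCount_nonneg (β : ℝ) (L : ℕ) [NeZero L] (m₀ ε : ℝ) :
    0 ≤ ∫ U, (Multiset.countP (fun z : ℂ => |z.re| < ε) (spinorLift gammaFive * wilsonDirac (fundamentalRep (Fin 3)) U m₀ 1).charpoly.roots : ℝ) ∂(wilsonMeasure (d := 4) (L := L) (fundamentalRep (Fin 3)) β) :=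
  integral_nonneg fun _ => Nat.cast_nonneg _

/-- `E N ≤ 12 L⁴`, integrable or not (a non-integrable integrand has Bochner integral `0`; the
Wilson measure of `SU(3)` is a probability measure, `isProbabilityMeasure_wilsonMeasure_fundamental`).
[folklore] -/
theorem expWindowCount_le_dim (β : ℝ) (L : ℕ) [NeZero L] (m₀ ε : ℝ) :
    ∫ U, (Multiset.countP (fun z : ℂ => |z.re| < ε) (spinorLift gammaFive * wilsonDirac (fundamentalRep (Fin 3)) U m₀ 1).charpoly.roots : ℝ) ∂(wilsonMeasure (d := 4) (L := L) (fundamentalRep (Fin 3)) β) ≤ 12 * (L : ℝ) ^ 4 := by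
  have hconst : ∫ _U, (12 * (L : ℝ) ^ 4 : ℝ)
      ∂(wilsonMeasure (d := 4) (L := L) (fundamentalRep (Fin 3)) β) = 12 * (L : ℝ) ^ 4 := by
    simp [integral_const]
  rw [← hconst]
  exact integral_mono_of_nonneg (Filter.Eventually.of_forall fun U => Nat.cast_nonneg _)
    (integrable_const _) (Filter.Eventually.of_forall fun U => windowCount_cast_le_dim U m₀ ε)

/-- `E N = 0` for `ε ≤ 0`. [folklore] -/
theorem expWindowCount_eq_zero_of_nonpos (β : ℝ) (L : ℕ) [NeZero L] (m₀ : ℝ) {ε : ℝ}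
    (hε : ε ≤ 0) : ∫ U, (Multiset.countP (fun z : ℂ => |z.re| < ε) (spinorLift gammaFive * wilsonDirac (fundamentalRep (Fin 3)) U m₀ 1).charpoly.roots : ℝ) ∂(wilsonMeasure (d := 4) (L := L) (fundamentalRep (Fin 3)) β) = 0 := by
  simp [windowCount_eq_zero_of_nonpos _ _ hε]

/-! ## Load-bearing analysis -/

/-- **`0 < ε` is load-bearing** (trivially): with it dropped, `ε = -1`, `β = 1`, `L = 2`, `m₀ = 0`
gives left side `0` and right side `-32 C < 0`. [folklore] -/
theorem wegnerEstimate_false_without_epsPos :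
    ¬ ∃ C p : ℝ, 0 < C ∧ 0 ≤ p ∧ ∀ β : ℝ, 1 ≤ β → ∀ (L : ℕ) [NeZero L], 2 ≤ L →
      ∀ m₀ ε : ℝ, -1 ≤ m₀ → m₀ ≤ 0 → ε ≤ 1 →
        ∫ U, (Multiset.countP (fun z : ℂ => |z.re| < ε) (spinorLift gammaFive * wilsonDirac (fundamentalRep (Fin 3)) U m₀ 1).charpoly.roots : ℝ) ∂(wilsonMeasure (d := 4) (L := L) (fundamentalRep (Fin 3)) β) ≤ C * (1 + β ^ p) * ε * (L : ℝ) ^ 4 := by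
  rintro ⟨C, p, hC, -, h⟩
  have h1 := h 1 le_rfl 2 le_rfl 0 (-1) (by norm_num) le_rfl (by norm_num)
  rw [expWindowCount_eq_zero_of_nonpos 1 2 0 (by norm_num), Real.one_rpow] at h1
  norm_num at h1
  linarith

/-- **`ε ≤ 1` is not load-bearing**: the crux is equivalent to its version over all `ε > 0`
(for `ε ≥ 1` use `N ≤ 12 L⁴` and `C ↦ max C 12`). [folklore] -/
theorem wegnerEstimate_iff_allEps :
    WegnerEstimate ↔ ∃ C p : ℝ, 0 < C ∧ 0 ≤ p ∧ ∀ β : ℝ, 1 ≤ β → ∀ (L : ℕ) [NeZero L], 2 ≤ L →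
      ∀ m₀ ε : ℝ, -1 ≤ m₀ → m₀ ≤ 0 → 0 < ε →
        ∫ U, (Multiset.countP (fun z : ℂ => |z.re| < ε) (spinorLift gammaFive * wilsonDirac (fundamentalRep (Fin 3)) U m₀ 1).charpoly.roots : ℝ) ∂(wilsonMeasure (d := 4) (L := L) (fundamentalRep (Fin 3)) β) ≤ C * (1 + β ^ p) * ε * (L : ℝ) ^ 4 := by
  constructor
  · rintro ⟨C, p, hC, hp, h⟩
    refine ⟨max C 12, p, lt_max_of_lt_left hC, hp, fun β hβ L _ hL m₀ ε hm hm' hε => ?_⟩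
    have hβp : (1 : ℝ) ≤ 1 + β ^ p := le_add_of_nonneg_right (Real.rpow_nonneg (by linarith) p)
    have hL4 : (0 : ℝ) ≤ (L : ℝ) ^ 4 := by positivity
    have hfac : (0 : ℝ) ≤ (1 + β ^ p) * ε * (L : ℝ) ^ 4 :=
      mul_nonneg (mul_nonneg (by linarith) hε.le) hL4
    by_cases h1 : ε ≤ 1
    · calc ∫ U, (Multiset.countP (fun z : ℂ => |z.re| < ε) (spinorLift gammaFive * wilsonDirac (fundamentalRep (Fin 3)) U m₀ 1).charpoly.roots : ℝ) ∂(wilsonMeasure (d := 4) (L := L) (fundamentalRep (Fin 3)) β)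
            ≤ C * (1 + β ^ p) * ε * (L : ℝ) ^ 4 := h β hβ L hL m₀ ε hm hm' hε h1
        _ = C * ((1 + β ^ p) * ε * (L : ℝ) ^ 4) := by ring
        _ ≤ max C 12 * ((1 + β ^ p) * ε * (L : ℝ) ^ 4) :=
            mul_le_mul_of_nonneg_right (le_max_left _ _) hfac
        _ = max C 12 * (1 + β ^ p) * ε * (L : ℝ) ^ 4 := by ring
    · have h1' : 1 ≤ ε := (not_le.mp h1).le
      have hab : 12 ≤ max C 12 * (1 + β ^ p) := by
        nlinarith [le_max_right C 12, mul_nonneg (sub_nonneg.2 (le_max_right C 12)) (sub_nonneg.2 hβp)]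
      have habe : 12 ≤ max C 12 * (1 + β ^ p) * ε := by
        nlinarith [mul_nonneg (sub_nonneg.2 hab) (sub_nonneg.2 h1')]
      calc ∫ U, (Multiset.countP (fun z : ℂ => |z.re| < ε) (spinorLift gammaFive * wilsonDirac (fundamentalRep (Fin 3)) U m₀ 1).charpoly.roots : ℝ) ∂(wilsonMeasure (d := 4) (L := L) (fundamentalRep (Fin 3)) β)
            ≤ 12 * (L : ℝ) ^ 4 := expWindowCount_le_dim β L m₀ ε
        _ ≤ max C 12 * (1 + β ^ p) * ε * (L : ℝ) ^ 4 := mul_le_mul_of_nonneg_right habe hL4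
  · rintro ⟨C, p, hC, hp, h⟩
    exact ⟨C, p, hC, hp, fun β hβ L _ hL m₀ ε hm hm' hε _ => h β hβ L hL m₀ ε hm hm' hε⟩

/-- **All content is at `ε → 0`**: on windows `ε ≥ ε₀ > 0` the bound holds with `C = 12/ε₀`, `p = 0`,
for every `β`, `L`, `m₀`. [folklore] -/
theorem wegnerEstimate_restricted_to_eps_ge {ε₀ : ℝ} (hε₀ : 0 < ε₀) :
    ∀ β : ℝ, ∀ (L : ℕ) [NeZero L], ∀ m₀ ε : ℝ, ε₀ ≤ ε →
      ∫ U, (Multiset.countP (fun z : ℂ => |z.re| < ε) (spinorLift gammaFive * wilsonDirac (fundamentalRep (Fin 3)) U m₀ 1).charpoly.roots : ℝ) ∂(wilsonMeasure (d := 4) (L := L) (fundamentalRep (Fin 3)) β) ≤ 12 / ε₀ * (1 + β ^ (0 : ℝ)) * ε * (L : ℝ) ^ 4 := by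
  intro β L _ m₀ ε hε
  have hL4 : (0 : ℝ) ≤ (L : ℝ) ^ 4 := by positivity
  calc ∫ U, (Multiset.countP (fun z : ℂ => |z.re| < ε) (spinorLift gammaFive * wilsonDirac (fundamentalRep (Fin 3)) U m₀ 1).charpoly.roots : ℝ) ∂(wilsonMeasure (d := 4) (L := L) (fundamentalRep (Fin 3)) β)
        ≤ 12 * (L : ℝ) ^ 4 := expWindowCount_le_dim β L m₀ ε
    _ = 12 / ε₀ * ε₀ * (L : ℝ) ^ 4 := by field_simp
    _ ≤ 12 / ε₀ * (1 + β ^ (0 : ℝ)) * ε * (L : ℝ) ^ 4 := by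
      rw [Real.rpow_zero]
      have h12 : (0 : ℝ) ≤ 12 / ε₀ := by positivity
      have : 12 / ε₀ * ε₀ ≤ 12 / ε₀ * (1 + 1) * ε := by nlinarith
      exact mul_le_mul_of_nonneg_right this hL4

/-- **Hölder fallback**: the crux implies the `ε^α` variant for every `α ≤ 1` (`ε ≤ ε^α` on `(0,1]`).
A Hölder Wegner estimate costs the route only the margin `(1-α)/(4b₀)` in its extinction exponent.
[folklore] -/
theorem wegnerEstimate_imp_holder (hW : WegnerEstimate) {α : ℝ} (hα1 : α ≤ 1) :
    ∃ C p : ℝ, 0 < C ∧ 0 ≤ p ∧ ∀ β : ℝ, 1 ≤ β → ∀ (L : ℕ) [NeZero L], 2 ≤ L →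
      ∀ m₀ ε : ℝ, -1 ≤ m₀ → m₀ ≤ 0 → 0 < ε → ε ≤ 1 →
        ∫ U, (Multiset.countP (fun z : ℂ => |z.re| < ε) (spinorLift gammaFive * wilsonDirac (fundamentalRep (Fin 3)) U m₀ 1).charpoly.roots : ℝ) ∂(wilsonMeasure (d := 4) (L := L) (fundamentalRep (Fin 3)) β) ≤ C * (1 + β ^ p) * ε ^ α * (L : ℝ) ^ 4 := by
  obtain ⟨C, p, hC, hp, h⟩ := hW
  refine ⟨C, p, hC, hp, fun β hβ L _ hL m₀ ε hm hm' hε hε1 => ?_⟩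
  have hεα : ε ≤ ε ^ α := by
    calc ε = ε ^ (1 : ℝ) := (Real.rpow_one ε).symm
      _ ≤ ε ^ α := Real.rpow_le_rpow_of_exponent_ge hε hε1 hα1
  have hfac : 0 ≤ C * (1 + β ^ p) :=
    mul_nonneg hC.le (by linarith [Real.rpow_nonneg (show (0:ℝ) ≤ β by linarith) p])
  have hL4 : (0 : ℝ) ≤ (L : ℝ) ^ 4 := by positivity
  calc ∫ U, (Multiset.countP (fun z : ℂ => |z.re| < ε) (spinorLift gammaFive * wilsonDirac (fundamentalRep (Fin 3)) U m₀ 1).charpoly.roots : ℝ) ∂(wilsonMeasure (d := 4) (L := L) (fundamentalRep (Fin 3)) β)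
        ≤ C * (1 + β ^ p) * ε * (L : ℝ) ^ 4 := h β hβ L hL m₀ ε hm hm' hε hε1
    _ ≤ C * (1 + β ^ p) * ε ^ α * (L : ℝ) ^ 4 := by gcongr

/-! ## Structure lemmas -/

/-- **`(Γ₅ D)² = Dᴴ D`**: the crux counts SINGULAR VALUES of the non-normal Wilson–Dirac operator
`D_W(U, m₀, 1)` below `ε` (an anti-concentration statement for `σ_min`-type quantities of
`D_W(U,0,1) + m₀`, uniformly in the real shift), not real eigenvalues of `D_W`. [folklore] -/
theorem hermitianWilsonDirac_mul_self {L : ℕ} [NeZero L] (U : GaugeConfig 4 L SU3) (m₀ : ℝ) :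
    (spinorLift gammaFive * wilsonDirac (fundamentalRep (Fin 3)) U m₀ 1) *
        (spinorLift gammaFive * wilsonDirac (fundamentalRep (Fin 3)) U m₀ 1) =
      (wilsonDirac (fundamentalRep (Fin 3)) U m₀ 1)ᴴ * wilsonDirac (fundamentalRep (Fin 3)) U m₀ 1 := by
  have hρ : ∀ g, fundamentalRep (Fin 3) g ∈ Matrix.unitaryGroup (Fin 3) ℂ :=
    fundamentalRep_mem_unitaryGroup
  rw [← wilsonDirac_gammaFive_hermitian_holds (fundamentalRep (Fin 3)) hρ U m₀ 1]
  simp only [Matrix.mul_assoc]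

/-- **Mass shift** `Γ₅ D_W(U,m₀,1) = Γ₅ D_W(U,0,1) + m₀ Γ₅`: a rank-full, non-sign-definite
perturbation (slopes of eigenvalue branches = chiralities `⟨ψ, Γ₅ψ⟩ ∈ [-1,1]`). [folklore] -/
theorem hermitianWilsonDirac_mass_shift {L : ℕ} [NeZero L] (U : GaugeConfig 4 L SU3) (m₀ : ℝ) :
    spinorLift gammaFive * wilsonDirac (fundamentalRep (Fin 3)) U m₀ 1 =
      spinorLift gammaFive * wilsonDirac (fundamentalRep (Fin 3)) U 0 1 +
        (m₀ : ℂ) • spinorLift gammaFive := by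
  have h := wilsonDirac_add_mass (fundamentalRep (Fin 3)) U 0 m₀ 1
  rw [zero_add] at h
  rw [h, Matrix.mul_add, Matrix.mul_smul, Matrix.mul_one]

/-! ## Gauge invariance of the window count; window modes on the whole pure-gauge orbit -/

/-- The spin matrix `Γ₅`-lift commutes with colour gauge rotations. [folklore] -/
theorem spinorLift_gammaFive_mul_gaugeRotation {L : ℕ} [NeZero L] {G : Type*} [Group G]
    (ρ : G →* Matrix (Fin 3) (Fin 3) ℂ) (g : TorusSite 4 L → G) :
    (spinorLift gammaFive : Matrix (TorusSite 4 L × Fin 3 × Fin 4) _ ℂ) * gaugeRotation ρ (Fin 4) g =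
      gaugeRotation ρ (Fin 4) g * spinorLift gammaFive := by
  rw [spinorLift_gammaFive_eq_diagonal]
  ext p q
  rw [diagonal_mul, mul_diagonal]
  simp only [gaugeRotation, Matrix.of_apply, Matrix.one_apply]
  by_cases h : p.2.2 = q.2.2
  · rw [h, mul_comm]
  · simp [h]

/-- **Gauge covariance of the Hermitian Wilson–Dirac operator**: `γ₅D_W(U^g) = 𝒢(g) γ₅D_W(U) 𝒢(g)⁻¹`
(tree `wilsonDirac_gaugeTransform` and `[Γ₅, 𝒢] = 0`). [folklore] -/
theorem hermitianWilsonDirac_gaugeTransform {L : ℕ} [NeZero L] {G : Type*} [Group G]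
    (ρ : G →* Matrix (Fin 3) (Fin 3) ℂ) (g : TorusSite 4 L → G) (U : GaugeConfig 4 L G) (m r : ℝ) :
    spinorLift gammaFive * wilsonDirac ρ (gaugeTransform g U) m r =
      gaugeRotation ρ (Fin 4) g * (spinorLift gammaFive * wilsonDirac ρ U m r) *
        gaugeRotation ρ (Fin 4) g⁻¹ := by
  rw [wilsonDirac_gaugeTransform, ← Matrix.mul_assoc, ← Matrix.mul_assoc,
    spinorLift_gammaFive_mul_gaugeRotation]
  simp only [Matrix.mul_assoc]

/-- **The characteristic polynomial of `γ₅D_W` — hence every window count — is gauge invariant.**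
[folklore] -/
theorem charpoly_hermitianWilsonDirac_gaugeTransform {L : ℕ} [NeZero L] {G : Type*} [Group G]
    (ρ : G →* Matrix (Fin 3) (Fin 3) ℂ) (g : TorusSite 4 L → G) (U : GaugeConfig 4 L G) (m r : ℝ) :
    (spinorLift gammaFive * wilsonDirac ρ (gaugeTransform g U) m r).charpoly =
      (spinorLift gammaFive * wilsonDirac ρ U m r).charpoly := by
  rw [hermitianWilsonDirac_gaugeTransform, Matrix.mul_assoc, Matrix.charpoly_mul_comm,
    Matrix.mul_assoc, gaugeRotation_inv_mul, Matrix.mul_one]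

/-- **Window modes on the whole pure-gauge orbit**: for every gauge function `g`, the pure gauge
`U = 1^g` carries an eigenvalue of `γ₅D_W(U, m₀, 1)` in `(-ε, ε)` whenever `ε > |m₀|` (sibling
`window_one_pos` transported by gauge invariance).  This is the configuration-wise half of the toron
floor; the measure half (mass of a `β^{-1/4}`-neighbourhood of this orbit under the Wilson measure as
`β → ∞`) is the open part. [folklore] -/
theorem window_pureGauge_pos {L : ℕ} [NeZero L] (g : TorusSite 4 L → SU3) {m₀ ε : ℝ}
    (h : |m₀| < ε) :
    0 < Multiset.countP (fun z : ℂ => |z.re| < ε)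
      (spinorLift gammaFive *
        wilsonDirac (fundamentalRep (Fin 3)) (gaugeTransform g (1 : GaugeConfig 4 L SU3)) m₀ 1
        ).charpoly.roots := by
  rw [charpoly_hermitianWilsonDirac_gaugeTransform]
  exact window_one_pos h

/-! ## Tightness: the polynomial factor in `β` is necessary, modulo the toron floor -/

/-- **No `β`-uniform Wegner estimate, given the toron floor.**  Hypothesis (TORON FLOOR, the
analytic input, stated in its weakest useful form): `∃ c > 0, ∀ δ > 0, ∃ β ≥ 1, ∃ m₀ ∈ [-1,0],
∃ ε ∈ (0,δ], c ≤ E_{β,2} N(ε; m₀)` — on the `2⁴` torus, windows of vanishing width keep expected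
count `≥ c`.  Mechanism (heuristic; Coste–González-Arroyo–Jurkiewicz–Korthals-Altes 1985, van Baal
1988: zero-momentum/toron dominance at weak coupling in a periodic box): the pure-gauge `SU(3)` Wilson
measure on a fixed torus concentrates as `β → ∞` on the `3⁴` centre sectors of flat connections with
holonomy angles `|θ| ≍ β^{-1/4}` (the Gaussian weight `(βθ²)^{-9}` of the 18 constant off-Cartan
modes beats the Weyl factor `θ⁶` and phase space `θ⁷dθ`); in the trivial sector (mass `→ 1/81`) the
12 constant modes of `γ₅ D_W(U,0,1)` sit at `≈ ±|θ^a|/2`, so `E_{β,2}N(ε;0) → 12/81` for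
`β^{-1/4} ≪ ε ≤ 1/2`.  Conclusion: the `p = 0` strengthening of the crux fails; a proof of the crux must
spend `p > 0` (heuristically `p ≥ 1/4`, from `sup_ε E N/ε ≍ β^{1/4}`). [folklore] -/
theorem not_wegnerEstimate_pZero_of_toronFloor
    (hT : ∃ c : ℝ, 0 < c ∧ ∀ δ : ℝ, 0 < δ → ∃ β : ℝ, 1 ≤ β ∧ ∃ m₀ : ℝ, -1 ≤ m₀ ∧ m₀ ≤ 0 ∧
      ∃ ε : ℝ, 0 < ε ∧ ε ≤ δ ∧ c ≤ ∫ U, (Multiset.countP (fun z : ℂ => |z.re| < ε) (spinorLift gammaFive * wilsonDirac (fundamentalRep (Fin 3)) U m₀ 1).charpoly.roots : ℝ) ∂(wilsonMeasure (d := 4) (L := 2) (fundamentalRep (Fin 3)) β)) :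
    ¬ ∃ C : ℝ, 0 < C ∧ ∀ β : ℝ, 1 ≤ β → ∀ (L : ℕ) [NeZero L], 2 ≤ L →
      ∀ m₀ ε : ℝ, -1 ≤ m₀ → m₀ ≤ 0 → 0 < ε → ε ≤ 1 →
        ∫ U, (Multiset.countP (fun z : ℂ => |z.re| < ε) (spinorLift gammaFive * wilsonDirac (fundamentalRep (Fin 3)) U m₀ 1).charpoly.roots : ℝ) ∂(wilsonMeasure (d := 4) (L := L) (fundamentalRep (Fin 3)) β) ≤ C * ε * (L : ℝ) ^ 4 := by
  rintro ⟨C, hC, h⟩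
  obtain ⟨c, hc, hT⟩ := hT
  obtain ⟨β, hβ, m₀, hm, hm', ε, hε, hεδ, hfloor⟩ := hT (min 1 (c / (32 * C))) (by positivity)
  have hε1 : ε ≤ 1 := hεδ.trans (min_le_left _ _)
  have hεc : ε ≤ c / (32 * C) := hεδ.trans (min_le_right _ _)
  have hb := h β hβ 2 le_rfl m₀ ε hm hm' hε hε1
  norm_num at hb
  have hCε : C * ε ≤ c / 32 := by
    calc C * ε ≤ C * (c / (32 * C)) := mul_le_mul_of_nonneg_left hεc hC.le
      _ = c / 32 := by field_simp
  linarith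

end Summit.QuantumFields.QCD.Theorems.WegnerEstimateNegative
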